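import Mathlib
import HarnessLib
import Summits.Ventures.LatticeQCDFlow.Exactness.NCMCGeneralSpaceOccupancyChainDoeblinWilson
import Summits.Ventures.LatticeQCDFlow.Exactness.NCMCGeneralSpaceOccupancyChainSweeps

/-!
# Composite level samplers (heat bath then any exact update): the two-step certificate survives, so `1HB + n OR` between switches converges from EVERY start with certified error bars

HONEST FRAMING: exact (Metropolis-corrected) sampling algorithms for lattice gauge theory;
figures of merit are autocorrelation/cost numbers at stated couplings and volumes; no
continuum-physics claim.

Venture `LatticeQCDFlow` (cell pub-lqcd), topic `Exactness`; FANOUT row 13 (`eng-snf`, GEN-18).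
NEW WORK of the cell, not a published result; no definition is introduced; nothing is cited as a
fact.  GEN-17's `NCMCGeneralSpaceOccupancyChainSweeps.lean` (`CrooksPair.ncmc_comp`,
`CrooksPair.ncmc_wilsonHeatBathComp`): with level samplers `η ∘ₖ K` — a minorised exact `K` (heat
bath) followed by ANY exact Markov `η` (over-relaxation sweeps) — the NCMC chain is ergodic and
consistent from `π_c`.  GEN-18's existential two-step certificate
(`NCMCGeneralSpaceOccupancyChainDoeblinMirror.CrooksPair.ncmc_exists_sq_doeblin`) asks for
`m ≤ (η ∘ₖ K)(z, ·)` — supplied by `NCMCGeneralSpaceSweepRestart.measure_le_comp` with `m ∘ η` —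
and `ν ≪ m ∘ η`, which this file derives from `ν ≪ m` and the invariance `ν ∘ η = ν` (absolute
continuity passes through `Measure.bind`).  Hence every GEN-18 conclusion for the engine's
`composite_sweep` (`1HB + n_or OR`) level samplers.

## Content

* §1 `absolutelyContinuous_bind_bind` (`ν ≪ m ⇒ ν ∘ η ≪ m ∘ η`),
  `absolutelyContinuous_bind_of_invariant` (`ν ∘ η = ν`, `ν ≪ m ⇒ ν ≪ m ∘ η`).
* §2 **`CrooksPair.ncmc_comp_exists_sq_doeblin`** — Crooks pair; `K₀`, `K₁` minorised by finite
  non-zero `m₀`, `m₁` with `ν₀ ≪ m₀`, `ν₁ ≪ m₁`; `η₀`, `η₁` Markov and invariant; the forward work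
  not almost surely `c`: the iteration kernel with level samplers `η₀ ∘ₖ K₀`, `η₁ ∘ₖ K₁` has a
  Doeblin square (`∃ ε ≠ 0, ν`); **`CrooksPair.ncmc_comp_everyStart`** — hence (with `K_k`, `η_k`
  invariant) from EVERY initial state `p̂_n → σ(c − ΔF)` and `dF_occ,n → ΔF` a.s.
* §3 **`CrooksPair.ncmc_wilsonHeatBathComp_everyStart`** — THE `composite_sweep` INSTANCE: torus
  Wilson theory, prior / target `wilsonWeight ρ β₀ / β₁`, level samplers = heat-bath link sweep then
  any exact `η_k` (`n_or` over-relaxation sweeps), ANY Crooks pair, ANY `c` with the forward work not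
  almost surely `c`: from EVERY initial state occupancy and `dF_occ` converge a.s.;
  **`CrooksPair.ncmc_wilsonHeatBathComp_errorBars`** — `∃ ε ∈ (0, 1]` with the burn-in, variance and
  `dF_occ`-deviation bounds of `…DoeblinHeatBath`.

NOT CLAIMED: the SU(N) Cabibbo–Marinari sweep instance (same assembly with `latSweep_minorised`);
the value of `ε`; anything numerical.
-/

namespace Summit.Ventures.LatticeQCDFlow.Exactness.GeneralNCMC

open MeasureTheory ProbabilityTheory Set Filter Finset
open scoped ENNReal Topology

/-! ## §1 Absolute continuity passes through `bind` -/

section AC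

variable {Ω : Type*} [MeasurableSpace Ω]

/-- `ν ≪ m ⇒ ν ∘ η ≪ m ∘ η` for every kernel `η`. -/
theorem absolutelyContinuous_bind_bind (η : Kernel Ω Ω) {ν m : Measure Ω} (hac : ν ≪ m) :
    ν.bind η ≪ m.bind η := by
  refine Measure.AbsolutelyContinuous.mk fun B hB h0 => ?_
  rw [Measure.bind_apply hB (Kernel.aemeasurable _)] at h0 ⊢
  rw [lintegral_eq_zero_iff (Kernel.measurable_coe η hB)] at h0
  rw [lintegral_congr_ae (hac.ae_le h0)]
  simp

/-- **A weight that an exact kernel leaves invariant inherits absolute continuity with respect to the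
pushed-forward minorising measure**: `ν ∘ η = ν`, `ν ≪ m ⇒ ν ≪ m ∘ η`. -/
theorem absolutelyContinuous_bind_of_invariant {η : Kernel Ω Ω} {ν m : Measure Ω}
    (hη : Kernel.Invariant η ν) (hac : ν ≪ m) : ν ≪ m.bind η := by
  have h := absolutelyContinuous_bind_bind η hac
  rwa [hη.def] at h

end AC

/-! ## §2 Composite level samplers keep the two-step certificate -/

section Comp

variable {Ω E : Type*} [MeasurableSpace Ω] [MeasurableSpace E]
  {ν₀ ν₁ : Measure Ω} [IsFiniteMeasure ν₀] [IsFiniteMeasure ν₁]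
  {κF κR : Kernel Ω E} [IsMarkovKernel κF] [IsMarkovKernel κR] {s e : E → Ω} {W : E → ℝ}

omit [IsFiniteMeasure ν₀] [IsFiniteMeasure ν₁] in
/-- **Composite level samplers keep the Doeblin square.**  Crooks pair; `K₀`, `K₁` minorised by
finite non-zero `m₀`, `m₁` from every configuration with `ν₀ ≪ m₀`, `ν₁ ≪ m₁`; `η₀`, `η₁` Markov
kernels leaving `ν₀`, `ν₁` invariant; the forward work not almost surely equal to `c`.  Then the NCMC
iteration kernel with level samplers `η₀ ∘ₖ K₀`, `η₁ ∘ₖ K₁` has a Doeblin-minorised square. -/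
theorem CrooksPair.ncmc_comp_exists_sq_doeblin (h : CrooksPair ν₀ ν₁ κF κR s e W)
    (K₀ η₀ K₁ η₁ : Kernel Ω Ω) [IsMarkovKernel η₀] [IsMarkovKernel η₁]
    (hη₀ : Kernel.Invariant η₀ ν₀) (hη₁ : Kernel.Invariant η₁ ν₁)
    {m₀ m₁ : Measure Ω} [IsFiniteMeasure m₀] [IsFiniteMeasure m₁] (hm₀ : m₀ univ ≠ 0)
    (hm₁ : m₁ univ ≠ 0) (hmin₀ : ∀ z, m₀ ≤ K₀ z) (hmin₁ : ∀ z, m₁ ≤ K₁ z) (hac₀ : ν₀ ≪ m₀)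
    (hac₁ : ν₁ ≪ m₁) (c : ℝ) (hW : (ν₀.bind κF) {ε | W ε ≠ c} ≠ 0) :
    ∃ (ε : ℝ≥0∞) (ν : Measure (Bool × Ω)), IsProbabilityMeasure ν ∧ ε ≠ 0 ∧
      ∀ z, ε • ν ≤ nHit (switchKernel κF κR c W s e ∘ₖ levelKernel (η₀ ∘ₖ K₀) (η₁ ∘ₖ K₁)) 2 z := by
  haveI : IsFiniteMeasure (m₀.bind η₀) :=
    ⟨by rw [bind_apply_univ_of_markov η₀ m₀]; exact measure_lt_top _ _⟩
  haveI : IsFiniteMeasure (m₁.bind η₁) :=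
    ⟨by rw [bind_apply_univ_of_markov η₁ m₁]; exact measure_lt_top _ _⟩
  exact h.ncmc_exists_sq_doeblin (m₀ := m₀.bind η₀) (m₁ := m₁.bind η₁)
    (by rwa [bind_apply_univ_of_markov η₀ m₀]) (by rwa [bind_apply_univ_of_markov η₁ m₁])
    (measure_le_comp K₀ η₀ hmin₀) (measure_le_comp K₁ η₁ hmin₁)
    (absolutelyContinuous_bind_of_invariant hη₀ hac₀)
    (absolutelyContinuous_bind_of_invariant hη₁ hac₁) c hW

/-- **Composite level samplers: occupancy and `dF_occ` from EVERY initial state.**  As above, with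
`K₀`, `K₁` Markov and invariant as well: for EVERY initial state `z`, along the NCMC chain with level
samplers `η₀ ∘ₖ K₀`, `η₁ ∘ₖ K₁` started at `z`, `p̂_n → σ(c − ΔF)` and `dF_occ,n → ΔF` almost surely. -/
theorem CrooksPair.ncmc_comp_everyStart (h : CrooksPair ν₀ ν₁ κF κR s e W) (h0 : ν₀ univ ≠ 0)
    (h1 : ν₁ univ ≠ 0) (K₀ η₀ K₁ η₁ : Kernel Ω Ω) [IsMarkovKernel K₀] [IsMarkovKernel η₀]
    [IsMarkovKernel K₁] [IsMarkovKernel η₁] (hK₀ : Kernel.Invariant K₀ ν₀)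
    (hη₀ : Kernel.Invariant η₀ ν₀) (hK₁ : Kernel.Invariant K₁ ν₁) (hη₁ : Kernel.Invariant η₁ ν₁)
    {m₀ m₁ : Measure Ω} [IsFiniteMeasure m₀] [IsFiniteMeasure m₁] (hm₀ : m₀ univ ≠ 0)
    (hm₁ : m₁ univ ≠ 0) (hmin₀ : ∀ z, m₀ ≤ K₀ z) (hmin₁ : ∀ z, m₁ ≤ K₁ z) (hac₀ : ν₀ ≪ m₀)
    (hac₁ : ν₁ ≪ m₁) (c : ℝ) (hW : (ν₀.bind κF) {ε | W ε ≠ c} ≠ 0) {ΔF : ℝ}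
    (hΔF : Real.exp (-ΔF) = ((ν₀ univ)⁻¹ * ν₁ univ).toReal) (z : Bool × Ω) :
    haveI := isMarkovKernel_switchKernel (κF := κF) (κR := κR) (c := c)
      h.measurable_W h.measurable_s h.measurable_e
    haveI := isMarkovKernel_levelKernel (η₀ ∘ₖ K₀) (η₁ ∘ₖ K₁)
    ∀ᵐ x ∂(Kernel.trajMeasure (X := fun _ : ℕ => Bool × Ω) (Measure.dirac z)
        (fun n : ℕ => (switchKernel κF κR c W s e ∘ₖ levelKernel (η₀ ∘ₖ K₀) (η₁ ∘ₖ K₁)).comap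
          (fun hh : (j : ↥(Finset.Iic n)) → Bool × Ω => hh ⟨n, Finset.mem_Iic.2 le_rfl⟩)
          (measurable_pi_apply _))),
      Tendsto (fun n : ℕ => (∑ i ∈ range n, (targetLevel Ω).indicator (1 : Bool × Ω → ℝ) (x i)) / n)
          atTop (𝓝 (Real.sigmoid (c - ΔF))) ∧
        Tendsto (fun n : ℕ => c - Real.log
            ((∑ i ∈ range n, (targetLevel Ω).indicator (1 : Bool × Ω → ℝ) (x i)) / n /
              (1 - (∑ i ∈ range n, (targetLevel Ω).indicator (1 : Bool × Ω → ℝ) (x i)) / n)))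
          atTop (𝓝 ΔF) :=
  h.ncmc_everyStart_of_exists_sq h0 h1 (hη₀.comp hK₀) (hη₁.comp hK₁)
    (h.ncmc_comp_exists_sq_doeblin K₀ η₀ K₁ η₁ hη₀ hη₁ hm₀ hm₁ hmin₀ hmin₁ hac₀ hac₁ c hW) hΔF z

end Comp

/-! ## §3 Torus Wilson theory: heat bath then any exact update (`1HB + n_or OR`), every start -/

section WilsonComp

open Literature.MathematicalPhysics.QuantumFieldTheory

variable {d L N : ℕ} {G : Type*} [Group G] [TopologicalSpace G] [IsTopologicalGroup G]
  (ρ : G →* Matrix (Fin N) (Fin N) ℂ) [CompactSpace G] [MeasurableSpace G] [BorelSpace G]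
  [SecondCountableTopology G]

/-- **THE `composite_sweep` INSTANCE FROM EVERY INITIAL STATE.**  Torus Wilson theory, compact
second-countable `G`, continuous `ρ`, `L ≠ 0`; prior `wilsonWeight ρ β₀`, target `wilsonWeight ρ β₁`;
level samplers = the heat-bath link sweep at `β_k` (edge list visiting every edge) followed by any
Markov kernel `η_k` leaving `wilsonWeight ρ β_k` invariant (the engine's `n_or` over-relaxation
sweeps); ANY Crooks pair, ANY `c` with the forward work not almost surely `c`: from EVERY initial
state the occupancy fraction converges to `σ(c − ΔF)` and `dF_occ,n` to `ΔF` almost surely. -/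
theorem CrooksPair.ncmc_wilsonHeatBathComp_everyStart [NeZero L] (hρ : Continuous ρ) (β₀ β₁ : ℝ)
    {l₀ l₁ : List (Edge d L)} (hl₀ : ∀ ed, ed ∈ l₀) (hl₁ : ∀ ed, ed ∈ l₁)
    (η₀ η₁ : Kernel (GaugeConfig d L G) (GaugeConfig d L G)) [IsMarkovKernel η₀] [IsMarkovKernel η₁]
    (hη₀ : Kernel.Invariant η₀ (wilsonWeight (d := d) (L := L) ρ β₀))
    (hη₁ : Kernel.Invariant η₁ (wilsonWeight (d := d) (L := L) ρ β₁))
    {E : Type*} [MeasurableSpace E] {κF κR : Kernel (GaugeConfig d L G) E} [IsMarkovKernel κF]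
    [IsMarkovKernel κR] {s e : E → GaugeConfig d L G} {W : E → ℝ}
    (h : CrooksPair (wilsonWeight (d := d) (L := L) ρ β₀) (wilsonWeight (d := d) (L := L) ρ β₁)
      κF κR s e W) (c : ℝ)
    (hW : ((wilsonWeight (d := d) (L := L) ρ β₀).bind κF) {ε | W ε ≠ c} ≠ 0) {ΔF : ℝ}
    (hΔF : Real.exp (-ΔF) = (((wilsonWeight (d := d) (L := L) ρ β₀) univ)⁻¹ *
      (wilsonWeight (d := d) (L := L) ρ β₁) univ).toReal) :
    ∃ (_ : IsMarkovKernel (switchKernel κF κR c W s e))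
      (_ : IsMarkovKernel (levelKernel
        (η₀ ∘ₖ cycle (l₀.map (siteHeatBath (fun _ : Edge d L => haarProbability G)
          (gibbsDensity fun U : GaugeConfig d L G => β₀ * wilsonAction ρ U))))
        (η₁ ∘ₖ cycle (l₁.map (siteHeatBath (fun _ : Edge d L => haarProbability G)
          (gibbsDensity fun U : GaugeConfig d L G => β₁ * wilsonAction ρ U)))))),
      ∀ z : Bool × GaugeConfig d L G,
        ∀ᵐ x ∂(Kernel.trajMeasure (X := fun _ : ℕ => Bool × GaugeConfig d L G) (Measure.dirac z)
          (fun n : ℕ => (switchKernel κF κR c W s e ∘ₖ levelKernel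
            (η₀ ∘ₖ cycle (l₀.map (siteHeatBath (fun _ : Edge d L => haarProbability G)
              (gibbsDensity fun U : GaugeConfig d L G => β₀ * wilsonAction ρ U))))
            (η₁ ∘ₖ cycle (l₁.map (siteHeatBath (fun _ : Edge d L => haarProbability G)
              (gibbsDensity fun U : GaugeConfig d L G => β₁ * wilsonAction ρ U))))).comap
            (fun hh : (j : ↥(Finset.Iic n)) → Bool × GaugeConfig d L G =>
              hh ⟨n, Finset.mem_Iic.2 le_rfl⟩) (measurable_pi_apply _))),
        Tendsto (fun n : ℕ => (∑ i ∈ range n,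
            (targetLevel (GaugeConfig d L G)).indicator (1 : Bool × GaugeConfig d L G → ℝ) (x i)) / n)
          atTop (𝓝 (Real.sigmoid (c - ΔF))) ∧
        Tendsto (fun n : ℕ => c - Real.log
            ((∑ i ∈ range n, (targetLevel (GaugeConfig d L G)).indicator
                (1 : Bool × GaugeConfig d L G → ℝ) (x i)) / n /
              (1 - (∑ i ∈ range n, (targetLevel (GaugeConfig d L G)).indicator
                (1 : Bool × GaugeConfig d L G → ℝ) (x i)) / n)))
          atTop (𝓝 ΔF) := by
  obtain ⟨hMk₀, hfin₀, -, -, h0, -, hK₀, -⟩ := wilson_heatBathSweep_package ρ hρ β₀ hl₀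
  obtain ⟨hMk₁, hfin₁, -, -, h1, -, hK₁, -⟩ := wilson_heatBathSweep_package ρ hρ β₁ hl₁
  obtain ⟨m₀, hmfin₀, hm₀, hmin₀, hac₀⟩ := wilson_heatBath_minorising ρ hρ β₀ hl₀
  obtain ⟨m₁, hmfin₁, hm₁, hmin₁, hac₁⟩ := wilson_heatBath_minorising ρ hρ β₁ hl₁
  haveI := hMk₀
  haveI := hMk₁
  haveI := hfin₀
  haveI := hfin₁
  haveI := hmfin₀
  haveI := hmfin₁
  refine ⟨isMarkovKernel_switchKernel (κF := κF) (κR := κR) (c := c)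
      h.measurable_W h.measurable_s h.measurable_e, isMarkovKernel_levelKernel _ _, fun z => ?_⟩
  exact h.ncmc_comp_everyStart h0 h1 _ η₀ _ η₁ hK₀ hη₀ hK₁ hη₁ hm₀ hm₁ hmin₀ hmin₁ hac₀ hac₁ c hW
    hΔF z

/-- **CERTIFIED ERROR BARS FOR THE `composite_sweep` INSTANCE.**  Same hypotheses: there is an
`ε ∈ (0, 1]` such that, with `σ = σ(c − ΔF)`: from ANY initial law `|E p̂_n − σ| ≤ 2/(ε n)`; in
equilibrium `Var p̂_n ≤ 2 (1/2 + (2/ε − 1)/(1 − σ)) σ(1 − σ)/n` and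
`P(|dF_occ,n − ΔF| ≥ η) ≤ that/δ_η²`, `δ_η = min(σ(c − ΔF + η) − σ, σ − σ(c − ΔF − η))`. -/
theorem CrooksPair.ncmc_wilsonHeatBathComp_errorBars [NeZero L] (hρ : Continuous ρ) (β₀ β₁ : ℝ)
    {l₀ l₁ : List (Edge d L)} (hl₀ : ∀ ed, ed ∈ l₀) (hl₁ : ∀ ed, ed ∈ l₁)
    (η₀ η₁ : Kernel (GaugeConfig d L G) (GaugeConfig d L G)) [IsMarkovKernel η₀] [IsMarkovKernel η₁]
    (hη₀ : Kernel.Invariant η₀ (wilsonWeight (d := d) (L := L) ρ β₀))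
    (hη₁ : Kernel.Invariant η₁ (wilsonWeight (d := d) (L := L) ρ β₁))
    {E : Type*} [MeasurableSpace E] {κF κR : Kernel (GaugeConfig d L G) E} [IsMarkovKernel κF]
    [IsMarkovKernel κR] {s e : E → GaugeConfig d L G} {W : E → ℝ}
    (h : CrooksPair (wilsonWeight (d := d) (L := L) ρ β₀) (wilsonWeight (d := d) (L := L) ρ β₁)
      κF κR s e W) (c : ℝ)
    (hW : ((wilsonWeight (d := d) (L := L) ρ β₀).bind κF) {ε | W ε ≠ c} ≠ 0) {ΔF : ℝ}
    (hΔF : Real.exp (-ΔF) = (((wilsonWeight (d := d) (L := L) ρ β₀) univ)⁻¹ *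
      (wilsonWeight (d := d) (L := L) ρ β₁) univ).toReal) :
    ∃ (_ : IsMarkovKernel (switchKernel κF κR c W s e))
      (_ : IsMarkovKernel (levelKernel
        (η₀ ∘ₖ cycle (l₀.map (siteHeatBath (fun _ : Edge d L => haarProbability G)
          (gibbsDensity fun U : GaugeConfig d L G => β₀ * wilsonAction ρ U))))
        (η₁ ∘ₖ cycle (l₁.map (siteHeatBath (fun _ : Edge d L => haarProbability G)
          (gibbsDensity fun U : GaugeConfig d L G => β₁ * wilsonAction ρ U))))))
      (_ : IsFiniteMeasure (wilsonWeight (d := d) (L := L) ρ β₀))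
      (_ : IsFiniteMeasure (wilsonWeight (d := d) (L := L) ρ β₁)) (ε : ℝ), 0 < ε ∧ ε ≤ 1 ∧
      (∀ (μ₀ : Measure (Bool × GaugeConfig d L G)) [IsProbabilityMeasure μ₀] (n : ℕ), n ≠ 0 →
        |∫ x, (∑ i ∈ range n, (targetLevel (GaugeConfig d L G)).indicator
              (1 : Bool × GaugeConfig d L G → ℝ) (x i)) / n
            ∂(Kernel.trajMeasure (X := fun _ : ℕ => Bool × GaugeConfig d L G) μ₀
              (fun n : ℕ => (switchKernel κF κR c W s e ∘ₖ levelKernel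
                (η₀ ∘ₖ cycle (l₀.map (siteHeatBath (fun _ : Edge d L => haarProbability G)
                  (gibbsDensity fun U : GaugeConfig d L G => β₀ * wilsonAction ρ U))))
                (η₁ ∘ₖ cycle (l₁.map (siteHeatBath (fun _ : Edge d L => haarProbability G)
                  (gibbsDensity fun U : GaugeConfig d L G => β₁ * wilsonAction ρ U))))).comap
                (fun hh : (j : ↥(Finset.Iic n)) → Bool × GaugeConfig d L G =>
                  hh ⟨n, Finset.mem_Iic.2 le_rfl⟩) (measurable_pi_apply _))) -
          Real.sigmoid (c - ΔF)| ≤ 2 / (ε * n)) ∧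
      (∀ n : ℕ, n ≠ 0 →
        Var[fun z : ℕ → Bool × GaugeConfig d L G => (∑ i ∈ range n,
            (targetLevel (GaugeConfig d L G)).indicator (1 : Bool × GaugeConfig d L G → ℝ) (z i)) / n;
          Kernel.trajMeasure (X := fun _ : ℕ => Bool × GaugeConfig d L G)
            ((jointWeight c (wilsonWeight (d := d) (L := L) ρ β₀)
              (wilsonWeight (d := d) (L := L) ρ β₁) univ)⁻¹ •
              jointWeight c (wilsonWeight (d := d) (L := L) ρ β₀) (wilsonWeight (d := d) (L := L) ρ β₁))
            (fun n : ℕ => (switchKernel κF κR c W s e ∘ₖ levelKernel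
              (η₀ ∘ₖ cycle (l₀.map (siteHeatBath (fun _ : Edge d L => haarProbability G)
                (gibbsDensity fun U : GaugeConfig d L G => β₀ * wilsonAction ρ U))))
              (η₁ ∘ₖ cycle (l₁.map (siteHeatBath (fun _ : Edge d L => haarProbability G)
                (gibbsDensity fun U : GaugeConfig d L G => β₁ * wilsonAction ρ U))))).comap
              (fun hh : (j : ↥(Finset.Iic n)) → Bool × GaugeConfig d L G =>
                hh ⟨n, Finset.mem_Iic.2 le_rfl⟩) (measurable_pi_apply _))] ≤
          2 * (1 / 2 + (2 / ε - 1) / (1 - Real.sigmoid (c - ΔF))) *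
            (Real.sigmoid (c - ΔF) * (1 - Real.sigmoid (c - ΔF))) / n) ∧
      (∀ n : ℕ, n ≠ 0 → ∀ η : ℝ, 0 < η →
        Kernel.trajMeasure (X := fun _ : ℕ => Bool × GaugeConfig d L G)
            ((jointWeight c (wilsonWeight (d := d) (L := L) ρ β₀)
              (wilsonWeight (d := d) (L := L) ρ β₁) univ)⁻¹ •
              jointWeight c (wilsonWeight (d := d) (L := L) ρ β₀) (wilsonWeight (d := d) (L := L) ρ β₁))
            (fun n : ℕ => (switchKernel κF κR c W s e ∘ₖ levelKernel
              (η₀ ∘ₖ cycle (l₀.map (siteHeatBath (fun _ : Edge d L => haarProbability G)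
                (gibbsDensity fun U : GaugeConfig d L G => β₀ * wilsonAction ρ U))))
              (η₁ ∘ₖ cycle (l₁.map (siteHeatBath (fun _ : Edge d L => haarProbability G)
                (gibbsDensity fun U : GaugeConfig d L G => β₁ * wilsonAction ρ U))))).comap
              (fun hh : (j : ↥(Finset.Iic n)) → Bool × GaugeConfig d L G =>
                hh ⟨n, Finset.mem_Iic.2 le_rfl⟩) (measurable_pi_apply _))
          {z | η ≤ |c - Real.log
              ((∑ i ∈ range n, (targetLevel (GaugeConfig d L G)).indicator
                  (1 : Bool × GaugeConfig d L G → ℝ) (z i)) / n /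
                (1 - (∑ i ∈ range n, (targetLevel (GaugeConfig d L G)).indicator
                  (1 : Bool × GaugeConfig d L G → ℝ) (z i)) / n)) - ΔF|} ≤
          ENNReal.ofReal (2 * (1 / 2 + (2 / ε - 1) / (1 - Real.sigmoid (c - ΔF))) *
            (Real.sigmoid (c - ΔF) * (1 - Real.sigmoid (c - ΔF))) / n /
            (min (Real.sigmoid (c - ΔF + η) - Real.sigmoid (c - ΔF))
              (Real.sigmoid (c - ΔF) - Real.sigmoid (c - ΔF - η))) ^ 2)) := by
  obtain ⟨hMk₀, hfin₀, -, -, h0, -, hK₀, -⟩ := wilson_heatBathSweep_package ρ hρ β₀ hl₀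
  obtain ⟨hMk₁, hfin₁, -, -, h1, -, hK₁, -⟩ := wilson_heatBathSweep_package ρ hρ β₁ hl₁
  obtain ⟨m₀, hmfin₀, hm₀, hmin₀, hac₀⟩ := wilson_heatBath_minorising ρ hρ β₀ hl₀
  obtain ⟨m₁, hmfin₁, hm₁, hmin₁, hac₁⟩ := wilson_heatBath_minorising ρ hρ β₁ hl₁
  haveI := hMk₀
  haveI := hMk₁
  haveI := hfin₀
  haveI := hfin₁
  haveI := hmfin₀
  haveI := hmfin₁
  obtain ⟨ε, hε0, hε1, hA, hB, hC⟩ := h.ncmc_errorBars_of_exists_sq h0 h1 (hη₀.comp hK₀)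
    (hη₁.comp hK₁) (h.ncmc_comp_exists_sq_doeblin _ η₀ _ η₁ hη₀ hη₁ hm₀ hm₁ hmin₀ hmin₁ hac₀ hac₁
      c hW) hΔF
  exact ⟨isMarkovKernel_switchKernel (κF := κF) (κR := κR) (c := c)
      h.measurable_W h.measurable_s h.measurable_e, isMarkovKernel_levelKernel _ _, hfin₀, hfin₁,
    ε, hε0, hε1, hA, hB, hC⟩

end WilsonComp

end Summit.Ventures.LatticeQCDFlow.Exactness.GeneralNCMC
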